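import Summits.AtomisticToContinuum.BoseEinsteinCondensation.Theorems.BECConjugateDominationHardCoreExtensionMaxFormApproximationFiniteRangeBookkeeping
import Summits.AtomisticToContinuum.BoseEinsteinCondensation.Theorems.BECInsertionCorrectorStaticResponseBoundTruncationCompactness
import HarnessLib

/-!
# MaxFormApproximation for hard cores, part 2/3: the cut-off step with the `L²` bookkeeping

Helper file (part 2 of 3) for the stub `stub_maxFormApproximationFiniteRange` (S-B) of line
`near-minimiser-slack-transfer` of the crux `BECConjugateDomination.HardCoreExtension`
(item stmt-AtomisticToContinuum-11786). Setting: `L > 0`, a measurable finite-range pair profile `v` (hard cores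
allowed), the maximal form `Q_v(ζ) = ∑ₙ (∑ₚ (2πnₚ/L)²)|⟪eₙ, ζ⟫|² + ∫ (W_v ∘ fromUnitTorusN L)|ζ|²` on
`L²((ℝ/ℤ)^{3N})` (Haar probability measure), and the FREE embedding `ι₀ = formEmbed ∘ graphEmbed` of the periodic
Bose `C¹` core (`PeriodicFormDomain.lean` with the auxiliary profile `0`).

* `maxFormApproximation_cutoffStep` — **the cut-off step of `PeriodicMaxFormBoundHardCoreStep.lean` with the
  `L²`-closeness kept**: if `ζ` is Bose-symmetric with hard-layer decay
  `∫_{fromUnitTorusN L ⁻¹' hardLayer v L s} |ζ|² = o(s²)`, then for every `ε > 0` there is a core function `Φ` with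
  `Q_v(ι₀Φ) ≤ (1 + ε) Q_v(ζ) + ε` and `‖ι₀Φ - ζ‖ ≤ ε`. Construction (verbatim the landed one): soften `v` off the
  `s/2`-neighbourhood of its hard radii (`awayProfile`), approximate `ζ` in the softened maximal form by a
  Bose-symmetric trigonometric polynomial `P` (`exists_symm_trigPoly_maxForm_approx_general`, `‖P - ζ‖ ≤ e`),
  realise `P = ι₀Ψ` (`exists_core_formEmbed_eq_sum_smul`) and multiply by the hard-layer cut-off `ξ_s` of
  `exists_hardLayer_cutoff`; the new line is `‖ι₀(ξ_sΨ) - ζ‖² ≤ 2‖P - ζ‖² + 2∫_{layer} |ζ|² ≤ 2e² + 2ε's²`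
  (`lintegral_cutoff_mul_sub_sq_le` of part 1, `…FiniteRangeBookkeeping.lean`).

References: B. Simon, *Maximal and minimal Schrödinger forms*, J. Operator Theory 1 (1979) 37–47, Thm. 2.1;
[ReedSimonIV1978] Thm. XIII.64.
-/

noncomputable section

namespace Summit.AtomisticToContinuum.BoseEinsteinCondensation.Cruxes.HardCoreExtension.NearMinTower

open MeasureTheory Filter Set Metric
open scoped ENNReal NNReal Topology
open Literature.MathematicalPhysics.QuantumManyBody.BoseGas
open Literature.MathematicalPhysics.QuantumManyBody.BoseGas.HardLayerAux
open UnitAddTorus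
open Summit.AtomisticToContinuum.BoseEinsteinCondensation.Cruxes.StaticResponseBound.UvThomsonForceWave
  (measurable_zeroProfile lintegral_periodicInteraction_zero_ne_top)

attribute [local instance] Literature.MathematicalPhysics.QuantumManyBody.BoseGas.formDomain_measureSpace
  Literature.MathematicalPhysics.QuantumManyBody.BoseGas.formDomain_isProbabilityMeasure
  Literature.MathematicalPhysics.QuantumManyBody.BoseGas.formDomain_isProbabilityMeasure_pi

open scoped InnerProductSpace

/-! ### The cut-off step with the `L²` bookkeeping -/

set_option maxHeartbeats 400000 in
/-- **The cut-off step of MaxFormApproximation for hard cores.** Let `v` be measurable of finite range, `L > 0`,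
`ζ ∈ L²((ℝ/ℤ)^{3N})` Bose-symmetric with hard-layer decay `∫_{fromUnitTorusN L ⁻¹' hardLayer v L s} |ζ|² ≤ ε' s²`
for all small `s` (every `ε' > 0`). Then for every `ε > 0` there is a periodic Bose `C¹` core function `Φ` whose
free-embedded class `ι₀Φ` has `Q_v(ι₀Φ) ≤ (1 + ε) Q_v(ζ) + ε` and `‖ι₀Φ - ζ‖ ≤ ε`.
[cite: ReedSimonIV1978, Thm. XIII.64] -/
theorem maxFormApproximation_cutoffStep :
    ∀ (v : ℝ → ℝ≥0∞), Measurable v → ∀ (R₀ : ℝ), (∀ r, R₀ < r → v r = 0) → ∀ (N : ℕ) (L : ℝ) (hL : 0 < L),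
      ∀ ζ : Lp ℂ 2 (volume : Measure (UnitAddTorus (Fin N × Fin 3))),
        (∀ (σ : Equiv.Perm (Fin N)) (n : Fin N × Fin 3 → ℤ),
          ⟪(mFourierLp 2 (fun p : Fin N × Fin 3 => n (σ p.1, p.2)) :
              Lp ℂ 2 (volume : Measure (UnitAddTorus (Fin N × Fin 3)))), ζ⟫_ℂ =
            ⟪(mFourierLp 2 n : Lp ℂ 2 (volume : Measure (UnitAddTorus (Fin N × Fin 3)))), ζ⟫_ℂ) →
        (∀ ε' : ℝ, 0 < ε' → ∃ s₀ : ℝ, 0 < s₀ ∧ ∀ s : ℝ, 0 < s → s ≤ s₀ →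
          ∫⁻ t in fromUnitTorusN L ⁻¹' (hardLayer v L s : Set (Config N)),
            ((‖(ζ : UnitAddTorus (Fin N × Fin 3) → ℂ) t‖₊ : ℝ≥0∞)) ^ 2 ≤ ENNReal.ofReal (ε' * s ^ 2)) →
        ∀ ε : ℝ, 0 < ε → ∃ Φ : periodicCore N L,
          (∑' n : Fin N × Fin 3 → ℤ, ENNReal.ofReal (∑ p, (2 * Real.pi * (n p : ℝ) / L) ^ 2) *
                (‖⟪(mFourierLp 2 n : Lp ℂ 2 (volume : Measure (UnitAddTorus (Fin N × Fin 3)))),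
                  formEmbed hL measurable_zeroProfile (lintegral_periodicInteraction_zero_ne_top N L)
                    ⟨graphEmbed hL measurable_zeroProfile (lintegral_periodicInteraction_zero_ne_top N L) Φ,
                      graphEmbed_mem_formDomain hL measurable_zeroProfile
                        (lintegral_periodicInteraction_zero_ne_top N L) Φ⟩⟫_ℂ‖₊ : ℝ≥0∞) ^ 2 +
              ∫⁻ t, periodicInteraction v L (fromUnitTorusN L t) *
                (‖(formEmbed hL measurable_zeroProfile (lintegral_periodicInteraction_zero_ne_top N L)
                    ⟨graphEmbed hL measurable_zeroProfile (lintegral_periodicInteraction_zero_ne_top N L) Φ,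
                      graphEmbed_mem_formDomain hL measurable_zeroProfile
                        (lintegral_periodicInteraction_zero_ne_top N L) Φ⟩ :
                  UnitAddTorus (Fin N × Fin 3) → ℂ) t‖₊ : ℝ≥0∞) ^ 2) ≤
            ENNReal.ofReal (1 + ε) *
                ((∑' n : Fin N × Fin 3 → ℤ, ENNReal.ofReal (∑ p, (2 * Real.pi * (n p : ℝ) / L) ^ 2) *
                    (‖⟪(mFourierLp 2 n : Lp ℂ 2 (volume : Measure (UnitAddTorus (Fin N × Fin 3)))), ζ⟫_ℂ‖₊ :
                      ℝ≥0∞) ^ 2) +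
                  ∫⁻ t, periodicInteraction v L (fromUnitTorusN L t) *
                    (‖(ζ : UnitAddTorus (Fin N × Fin 3) → ℂ) t‖₊ : ℝ≥0∞) ^ 2) + ENNReal.ofReal ε ∧
          ‖formEmbed hL measurable_zeroProfile (lintegral_periodicInteraction_zero_ne_top N L)
              ⟨graphEmbed hL measurable_zeroProfile (lintegral_periodicInteraction_zero_ne_top N L) Φ,
                graphEmbed_mem_formDomain hL measurable_zeroProfile
                  (lintegral_periodicInteraction_zero_ne_top N L) Φ⟩ - ζ‖ ≤ ε := by
  intro v hv R₀ hv0 N L hL ζ hsymm hlayer ε hε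
  classical
  -- the free auxiliary embedding
  have hv₀ : Measurable (0 : ℝ → ℝ≥0∞) := measurable_zeroProfile
  have hW₀ : ∫⁻ X in cellN N L, periodicInteraction (0 : ℝ → ℝ≥0∞) L X ≠ ⊤ :=
    lintegral_periodicInteraction_zero_ne_top N L
  change ∃ Φ : periodicCore N L,
    (∑' n : Fin N × Fin 3 → ℤ, ENNReal.ofReal (∑ p, (2 * Real.pi * (n p : ℝ) / L) ^ 2) *
          (‖⟪(mFourierLp 2 n : Lp ℂ 2 (volume : Measure (UnitAddTorus (Fin N × Fin 3)))),
            formEmbed hL hv₀ hW₀ ⟨graphEmbed hL hv₀ hW₀ Φ, graphEmbed_mem_formDomain hL hv₀ hW₀ Φ⟩⟫_ℂ‖₊ : ℝ≥0∞) ^ 2 +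
        ∫⁻ t, periodicInteraction v L (fromUnitTorusN L t) *
          (‖(formEmbed hL hv₀ hW₀ ⟨graphEmbed hL hv₀ hW₀ Φ, graphEmbed_mem_formDomain hL hv₀ hW₀ Φ⟩ :
            UnitAddTorus (Fin N × Fin 3) → ℂ) t‖₊ : ℝ≥0∞) ^ 2) ≤ _ ∧
    ‖formEmbed hL hv₀ hW₀ ⟨graphEmbed hL hv₀ hW₀ Φ, graphEmbed_mem_formDomain hL hv₀ hW₀ Φ⟩ - ζ‖ ≤ ε
  obtain ⟨K, hKdef⟩ : ∃ K : ℝ≥0∞,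
      K = ∑' n : Fin N × Fin 3 → ℤ, ENNReal.ofReal (∑ p, (2 * Real.pi * (n p : ℝ) / L) ^ 2) *
        (‖⟪(mFourierLp 2 n : Lp ℂ 2 (volume : Measure (UnitAddTorus (Fin N × Fin 3)))), ζ⟫_ℂ‖₊ : ℝ≥0∞) ^ 2 :=
    ⟨_, rfl⟩
  obtain ⟨V, hVdef⟩ : ∃ V : ℝ≥0∞, V = ∫⁻ t, periodicInteraction v L (fromUnitTorusN L t) *
      (‖(ζ : UnitAddTorus (Fin N × Fin 3) → ℂ) t‖₊ : ℝ≥0∞) ^ 2 := ⟨_, rfl⟩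
  rw [← hKdef, ← hVdef]
  -- the cut-offs and the scales
  obtain ⟨C, hC0, hcut⟩ := exists_hardLayer_cutoff (N := N) hL v
  obtain ⟨A₁, hA₁⟩ : ∃ A₁ : ℝ, A₁ = (1 + ε⁻¹) * (3 * N) * C ^ 2 := ⟨_, rfl⟩
  have hA₁0 : 0 ≤ A₁ := by rw [hA₁]; positivity
  obtain ⟨ε', hε'⟩ : ∃ ε' : ℝ, ε' = min (ε / (8 * (A₁ + 1))) (ε ^ 2 / 4) := ⟨_, rfl⟩
  have hε'0 : 0 < ε' := by rw [hε']; exact lt_min (by positivity) (by positivity)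
  have hε'le : ε' ≤ ε / (8 * (A₁ + 1)) := by rw [hε']; exact min_le_left _ _
  have hε'sq : ε' ≤ ε ^ 2 / 4 := by rw [hε']; exact min_le_right _ _
  obtain ⟨s₀, hs₀, hs₀layer⟩ := hlayer ε' hε'0
  obtain ⟨s, hsdef⟩ : ∃ s : ℝ, s = min (min s₀ L) 1 := ⟨_, rfl⟩
  have hs : 0 < s := by rw [hsdef]; exact lt_min (lt_min hs₀ hL) one_pos
  have hss₀ : s ≤ s₀ := by rw [hsdef]; exact (min_le_left _ _).trans (min_le_left _ _)
  have hsL : s ≤ L := by rw [hsdef]; exact (min_le_left _ _).trans (min_le_right _ _)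
  have hs1 : s ≤ 1 := by rw [hsdef]; exact min_le_right _ _
  have hJζ := hs₀layer s hs hss₀
  obtain ⟨ξ, hξdiff, hξper, hξsym, hξ01, hξ0, hξ1, hξD⟩ := hcut s hs hsL
  -- the softened profile
  set w : ℝ → ℝ≥0∞ := awayProfile v (s / 2) with hwdef
  have hw : Measurable w := measurable_awayProfile hv _
  have hwv : ∀ r, w r ≤ v r := fun r => awayProfile_le v _ r
  have hWint : ∫⁻ X in cellN N L, periodicInteraction w L X ≠ ⊤ :=
    lintegral_cellN_periodicInteraction_ne_top_of_lintegral_ne_top hL hw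
      (lintegral_awayProfile_norm_ne_top hv0 (half_pos hs)) N
  -- the accuracy of the trigonometric polynomial
  obtain ⟨e, hedef⟩ : ∃ e : ℝ, e = min (ε / 8) (min 1 (s ^ 2 * ε / (8 * (A₁ + 1)))) := ⟨_, rfl⟩
  have he0 : 0 < e := by rw [hedef]; exact lt_min (by positivity) (lt_min one_pos (by positivity))
  have he8 : e ≤ ε / 8 := by rw [hedef]; exact min_le_left _ _
  have he1 : e ≤ 1 := by rw [hedef]; exact (min_le_right _ _).trans (min_le_left _ _)
  have hes : e ≤ s ^ 2 * ε / (8 * (A₁ + 1)) := by rw [hedef]; exact (min_le_right _ _).trans (min_le_right _ _)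
  obtain ⟨S, a, hS, ha, hkin, hpot, hdist⟩ := exists_symm_trigPoly_maxForm_approx_general hL hw hWint ζ hsymm he0
  -- the polynomial as a core function (free embedding)
  obtain ⟨Ψc, hΨc⟩ := exists_core_formEmbed_eq_sum_smul hL hv₀ hW₀ hS ha
  set P : Lp ℂ 2 (volume : Measure (UnitAddTorus (Fin N × Fin 3))) :=
    ∑ m ∈ S, a m • (mFourierLp 2 m : Lp ℂ 2 (volume : Measure (UnitAddTorus (Fin N × Fin 3)))) with hPdef
  -- the cut-off product
  set Φc : periodicCore N L := ⟨fun X => (ξ X : ℂ) * (Ψc : Config N → ℂ) X,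
    ofReal_mul_mem_periodicCore hξdiff hξper hξsym Ψc.2⟩ with hΦc
  have hΦcX : ∀ X, (Φc : Config N → ℂ) X = (ξ X : ℂ) * (Ψc : Config N → ℂ) X := fun X => rfl
  have hΨ1 : ContDiff ℝ 1 (Ψc : Config N → ℂ) := Ψc.2.1
  set A : Set (Config N) := hardLayer v L s with hAdef
  have hAm : MeasurableSet A := measurableSet_hardLayer v L s
  have hfd0 : ∀ X ∉ A, fderiv ℝ ξ X = 0 := by
    intro X hX
    have hev : ξ =ᶠ[𝓝 X] fun _ => (1 : ℝ) := by
      filter_upwards [Metric.ball_mem_nhds X (show 0 < s / 10 by positivity)] with X' hX'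
      refine hξ1 X hX X' fun i => ?_
      rw [← dist_eq_norm]
      exact (dist_pi_lt_iff (by positivity)).1 (mem_ball.1 hX') i
    rw [hev.fderiv_eq, fderiv_const_apply]
  have hξone : ∀ X ∉ A, ξ X = 1 := fun X hX => hξ1 X hX X fun i => by rw [sub_self, norm_zero]; positivity
  have hξd : Differentiable ℝ ξ := hξdiff.differentiable one_ne_zero
  have hΨd : Differentiable ℝ (Ψc : Config N → ℂ) := hΨ1.differentiable one_ne_zero
  -- measurability facts
  have hWvm := measurable_periodicInteraction_hc (N := N) hv L
  have hWwm := measurable_periodicInteraction_hc (N := N) hw L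
  have hIm : Measurable (A.indicator (1 : Config N → ℝ≥0∞)) := measurable_one.indicator hAm
  have hΨsqm : Measurable fun X : Config N => ((‖(Ψc : Config N → ℂ) X‖₊ : ℝ≥0∞)) ^ 2 :=
    hΨ1.continuous.measurable.nnnorm.coe_nnreal_ennreal.pow_const _
  -- the dictionary between the torus and the cell
  have hKΦ := tsum_kinetic_formEmbed_graphEmbed hL hv₀ hW₀ Φc
  have hVΦ := lintegral_pot_formEmbed_graphEmbed hL hv₀ hW₀ Φc hWvm
  have hKP : (∑' n : Fin N × Fin 3 → ℤ, ENNReal.ofReal (∑ p, (2 * Real.pi * (n p : ℝ) / L) ^ 2) *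
      (‖⟪(mFourierLp 2 n : Lp ℂ 2 (volume : Measure (UnitAddTorus (Fin N × Fin 3)))), P⟫_ℂ‖₊ : ℝ≥0∞) ^ 2) =
      ∫⁻ X in cellN N L, kineticDensity (Ψc : Config N → ℂ) X := by
    rw [← hΨc]; exact tsum_kinetic_formEmbed_graphEmbed hL hv₀ hW₀ Ψc
  have hVP : ∫⁻ t, periodicInteraction w L (fromUnitTorusN L t) *
      (‖(P : UnitAddTorus (Fin N × Fin 3) → ℂ) t‖₊ : ℝ≥0∞) ^ 2 =
      ∫⁻ X in cellN N L, periodicInteraction w L X * (‖(Ψc : Config N → ℂ) X‖₊ : ℝ≥0∞) ^ 2 := by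
    rw [← hΨc]; exact lintegral_pot_formEmbed_graphEmbed hL hv₀ hW₀ Ψc hWwm
  have hJP : ∫⁻ t, A.indicator (1 : Config N → ℝ≥0∞) (fromUnitTorusN L t) *
      (‖(P : UnitAddTorus (Fin N × Fin 3) → ℂ) t‖₊ : ℝ≥0∞) ^ 2 =
      ∫⁻ X in cellN N L, A.indicator (1 : Config N → ℝ≥0∞) X * (‖(Ψc : Config N → ℂ) X‖₊ : ℝ≥0∞) ^ 2 := by
    rw [← hΨc]; exact lintegral_pot_formEmbed_graphEmbed hL hv₀ hW₀ Ψc hIm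
  -- the Config-side estimates
  obtain ⟨cD, hcD⟩ : ∃ cD : ℝ, cD = (1 + ε⁻¹) * (3 * N) * (C / s) ^ 2 := ⟨_, rfl⟩
  have hcD0 : 0 ≤ cD := by rw [hcD]; positivity
  have hI1 : ∫⁻ X in cellN N L, kineticDensity (Φc : Config N → ℂ) X ≤
      ENNReal.ofReal (1 + ε) * (∫⁻ X in cellN N L, kineticDensity (Ψc : Config N → ℂ) X) +
        ENNReal.ofReal cD *
          (∫⁻ X in cellN N L, A.indicator (1 : Config N → ℝ≥0∞) X * (‖(Ψc : Config N → ℂ) X‖₊ : ℝ≥0∞) ^ 2) := by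
    calc ∫⁻ X in cellN N L, kineticDensity (Φc : Config N → ℂ) X
        ≤ ∫⁻ X in cellN N L, (ENNReal.ofReal (1 + ε) * kineticDensity (Ψc : Config N → ℂ) X +
            ENNReal.ofReal cD * A.indicator (1 : Config N → ℝ≥0∞) X * (‖(Ψc : Config N → ℂ) X‖₊ : ℝ≥0∞) ^ 2) :=
          lintegral_mono fun X => by rw [hcD]; exact kineticDensity_cutoff_mul_le hξd hΨd hξ01 hξD hfd0 hε X
      _ = _ := by
          rw [lintegral_add_left ((measurable_kineticDensity_any _).const_mul _), lintegral_const_mul _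
            (measurable_kineticDensity_any _)]
          simp only [mul_assoc]
          rw [lintegral_const_mul _ (show Measurable (fun X : Config N => A.indicator (1 : Config N → ℝ≥0∞) X *
            ((‖(Ψc : Config N → ℂ) X‖₊ : ℝ≥0∞) ^ 2)) from hIm.mul hΨsqm)]
  have hI2 : ∫⁻ X in cellN N L, periodicInteraction v L X * (‖(Φc : Config N → ℂ) X‖₊ : ℝ≥0∞) ^ 2 ≤
      ∫⁻ X in cellN N L, periodicInteraction w L X * (‖(Ψc : Config N → ℂ) X‖₊ : ℝ≥0∞) ^ 2 :=
    lintegral_mono fun X => pot_ofReal_mul_le hξ01 hξ0 _ X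
  -- the mass of `P` in the layer
  obtain ⟨J, hJdef⟩ : ∃ J : ℝ≥0∞, J = ∫⁻ t, A.indicator (1 : Config N → ℝ≥0∞) (fromUnitTorusN L t) *
      (‖(P : UnitAddTorus (Fin N × Fin 3) → ℂ) t‖₊ : ℝ≥0∞) ^ 2 := ⟨_, rfl⟩
  rw [← hJdef] at hJP
  have htwo : ∀ x : ℝ, (2 : ℝ≥0∞) * ENNReal.ofReal x = ENNReal.ofReal (2 * x) := fun x => by
    rw [ENNReal.ofReal_mul (by norm_num), ENNReal.ofReal_ofNat]
  have hPζ : ENNReal.ofReal (‖P - ζ‖ ^ 2) ≤ ENNReal.ofReal (e ^ 2) :=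
    ENNReal.ofReal_le_ofReal (pow_le_pow_left₀ (norm_nonneg (P - ζ)) hdist 2)
  have hJ : J ≤ 2 * ENNReal.ofReal (ε' * s ^ 2) + 2 * ENNReal.ofReal (e ^ 2) := by
    rw [hJdef]
    exact (lintegral_indicator_mul_sq_le hAm L P ζ).trans (add_le_add (mul_le_mul_right hJζ _) (mul_le_mul_right hPζ _))
  -- the error budget in the reals
  have herr_real : cD * (2 * (ε' * s ^ 2) + 2 * e ^ 2) + e ≤ ε :=
    cutoffStep_energyBudget hε hs hA₁ hcD hε'le he0.le he8 he1 hes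
  have herr : ENNReal.ofReal cD * (2 * ENNReal.ofReal (ε' * s ^ 2) + 2 * ENNReal.ofReal (e ^ 2)) + ENNReal.ofReal e ≤
      ENNReal.ofReal ε := by
    rw [htwo, htwo, ← ENNReal.ofReal_add (by positivity) (by positivity), ← ENNReal.ofReal_mul hcD0,
      ← ENNReal.ofReal_add (by positivity) he0.le]
    exact ENNReal.ofReal_le_ofReal herr_real
  have hpotζ : ∫⁻ t, periodicInteraction w L (fromUnitTorusN L t) *
      (‖(ζ : UnitAddTorus (Fin N × Fin 3) → ℂ) t‖₊ : ℝ≥0∞) ^ 2 ≤ V := by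
    rw [hVdef]
    exact lintegral_mono fun t => mul_le_mul_left (periodicInteraction_mono_profile hwv L _) _
  refine ⟨Φc, ?_, ?_⟩
  · -- the energy
    rw [hKΦ, hVΦ]
    calc (∫⁻ X in cellN N L, kineticDensity (Φc : Config N → ℂ) X) +
          ∫⁻ X in cellN N L, periodicInteraction v L X * (‖(Φc : Config N → ℂ) X‖₊ : ℝ≥0∞) ^ 2
        ≤ (ENNReal.ofReal (1 + ε) * (∫⁻ X in cellN N L, kineticDensity (Ψc : Config N → ℂ) X) +
            ENNReal.ofReal cD *
              (∫⁻ X in cellN N L, A.indicator (1 : Config N → ℝ≥0∞) X * (‖(Ψc : Config N → ℂ) X‖₊ : ℝ≥0∞) ^ 2)) +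
          ∫⁻ X in cellN N L, periodicInteraction w L X * (‖(Ψc : Config N → ℂ) X‖₊ : ℝ≥0∞) ^ 2 := add_le_add hI1 hI2
      _ = ENNReal.ofReal (1 + ε) * (∑' n : Fin N × Fin 3 → ℤ, ENNReal.ofReal (∑ p, (2 * Real.pi * (n p : ℝ) / L) ^ 2) *
            (‖⟪(mFourierLp 2 n : Lp ℂ 2 (volume : Measure (UnitAddTorus (Fin N × Fin 3)))), P⟫_ℂ‖₊ : ℝ≥0∞) ^ 2) +
            ENNReal.ofReal cD * J +
          ∫⁻ t, periodicInteraction w L (fromUnitTorusN L t) *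
            (‖(P : UnitAddTorus (Fin N × Fin 3) → ℂ) t‖₊ : ℝ≥0∞) ^ 2 := by
          rw [hKP, hJP, hVP]
      _ ≤ ENNReal.ofReal (1 + ε) * K +
            ENNReal.ofReal cD * (2 * ENNReal.ofReal (ε' * s ^ 2) + 2 * ENNReal.ofReal (e ^ 2)) +
          (V + ENNReal.ofReal e) := by
          gcongr
          · rw [hKdef]; exact hkin
          · exact hpot.trans (add_le_add hpotζ le_rfl)
      _ = ENNReal.ofReal (1 + ε) * K + V +
          (ENNReal.ofReal cD * (2 * ENNReal.ofReal (ε' * s ^ 2) + 2 * ENNReal.ofReal (e ^ 2)) + ENNReal.ofReal e) := by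
          ring
      _ ≤ ENNReal.ofReal (1 + ε) * K + ENNReal.ofReal (1 + ε) * V + ENNReal.ofReal ε := by
          refine add_le_add (add_le_add le_rfl ?_) herr
          calc V = 1 * V := (one_mul V).symm
            _ ≤ ENNReal.ofReal (1 + ε) * V := by
                gcongr; rw [← ENNReal.ofReal_one]; exact ENNReal.ofReal_le_ofReal (by linarith)
      _ = ENNReal.ofReal (1 + ε) * (K + V) + ENNReal.ofReal ε := by ring
  · -- the distance
    have hιΦ := coeFn_formEmbed_graphEmbed hL hv₀ hW₀ Φc
    have hιΨ := coeFn_formEmbed_graphEmbed hL hv₀ hW₀ Ψc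
    rw [hΨc] at hιΨ
    obtain ⟨D, hDdef⟩ : ∃ D : Lp ℂ 2 (volume : Measure (UnitAddTorus (Fin N × Fin 3))),
        D = formEmbed hL hv₀ hW₀ ⟨graphEmbed hL hv₀ hW₀ Φc, graphEmbed_mem_formDomain hL hv₀ hW₀ Φc⟩ - ζ := ⟨_, rfl⟩
    rw [← hDdef]
    have hDsq : ENNReal.ofReal (‖D‖ ^ 2) ≤ 2 * ENNReal.ofReal (e ^ 2) + 2 * ENNReal.ofReal (ε' * s ^ 2) := by
      rw [(norm_Lp_two_sq_eq_toReal D).1, ENNReal.ofReal_toReal (norm_Lp_two_sq_eq_toReal D).2]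
      have hD : ∀ᵐ t ∂(volume : Measure (UnitAddTorus (Fin N × Fin 3))),
          (D : UnitAddTorus (Fin N × Fin 3) → ℂ) t = (ξ (fromUnitTorusN L t) : ℂ) *
            (P : UnitAddTorus (Fin N × Fin 3) → ℂ) t - (ζ : UnitAddTorus (Fin N × Fin 3) → ℂ) t := by
        rw [hDdef]
        filter_upwards [Lp.coeFn_sub (formEmbed hL hv₀ hW₀ ⟨graphEmbed hL hv₀ hW₀ Φc,
          graphEmbed_mem_formDomain hL hv₀ hW₀ Φc⟩) ζ, hιΦ, hιΨ] with t h1 h2 h3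
        rw [h1, Pi.sub_apply, h2, h3, hΦcX]
        ring
      rw [lintegral_congr_ae (hD.mono fun t ht =>
        show ((‖(D : UnitAddTorus (Fin N × Fin 3) → ℂ) t‖₊ : ℝ≥0∞)) ^ 2 =
          ((‖(ξ (fromUnitTorusN L t) : ℂ) * (P : UnitAddTorus (Fin N × Fin 3) → ℂ) t -
            (ζ : UnitAddTorus (Fin N × Fin 3) → ℂ) t‖₊ : ℝ≥0∞)) ^ 2 by rw [ht])]
      refine (lintegral_cutoff_mul_sub_sq_le hξ01 hAm hξone L P ζ).trans ?_
      exact add_le_add (mul_le_mul_right hPζ _) (mul_le_mul_right hJζ _)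
    -- back to the reals
    have hfin : 2 * ENNReal.ofReal (e ^ 2) + 2 * ENNReal.ofReal (ε' * s ^ 2) ≠ ⊤ := by
      rw [htwo, htwo]; exact ENNReal.add_ne_top.2 ⟨ENNReal.ofReal_ne_top, ENNReal.ofReal_ne_top⟩
    have hreal : ‖D‖ ^ 2 ≤ 2 * e ^ 2 + 2 * (ε' * s ^ 2) := by
      have h := ENNReal.toReal_mono hfin hDsq
      rwa [ENNReal.toReal_ofReal (sq_nonneg _), htwo, htwo,
        ENNReal.toReal_add ENNReal.ofReal_ne_top ENNReal.ofReal_ne_top, ENNReal.toReal_ofReal (by positivity),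
        ENNReal.toReal_ofReal (by positivity)] at h
    exact cutoffStep_distBudget hε hs hs1 hε'0.le hε'sq he0.le he8 (norm_nonneg D) hreal

end Summit.AtomisticToContinuum.BoseEinsteinCondensation.Cruxes.HardCoreExtension.NearMinTower

end
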